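import Summits.NavierStokesRegularity.NavierStokesRegularity.Theorems.LerayQuarterDissipationFiniteDissipationLiouvilleQuietVorticity
import Literature.Analysis.FluidPDE.Vorticity
import HarnessLib

/-!
# Crux `FiniteDissipationLiouville` (stmt-NavierStokesRegularity-22144): tools for the
# VORTICITY-ALIGNMENT leaf — an ALIGNED slice of a finite-dissipation Type-I profile vanishes

Theorems file of route `LerayQuarterDissipation` (lead prover ns-lqd-lead g8; `--supports` the
crux, line `birth`; portrait facts for the registered stub `stub_envelopeCriticalLiouville`).
Navier–Stokes regularity is NOT proved by anything here; no summit is.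

`𝒟_{C,K}`: Type-I ancient mild fields (KNSS gauge, `IsTypeIAncientMild C w`) with the law
`∫ ‖∇w(s)‖² ≤ K/√(−s)`.

* `slice_eq_zero_of_curl_parallel` — **ALIGNED SLICE ⇒ ZERO**: if at ONE instant `s < 0` the
  vorticity of a member of `𝒟_{C,K}` is everywhere parallel to one fixed vector `e`
  (`curl w(s)(x) = c(x) e`, signs and zeros free), the slice vanishes identically;
* `not_singular_of_curl_parallel_slice` — hence such a member is bounded at the apex (forward
  uniqueness from the zero slice, `CalmSlice.not_singular_of_zero_slice`).

Mechanism (the two-dimensional reduction of Giga–Miura's blow-up limit, made quantitative-free by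
the dissipation law): `−Δw = curl curl w = curl (c e) = ∇c × e ⊥ e`, so `⟪w(s), e⟫` is harmonic;
it lies in `L⁶(ℝ³)` (`Birth.memLp_six_slice`), hence vanishes (Liouville in `L^q`,
`eq_zero_of_harmonic_memLp`); the antisymmetric part of `Dw` is `curl w ×`, so
`∂ₑ w = ∇⟪w, e⟫ + (terms killed by curl w ∥ e) = 0` (`apply_eq_zero_of_curlCLM_eq_smul`, linear
algebra of `curlCLM`); the slice is then invariant under translation by `e ≠ 0`, and a continuous
`L⁶` field invariant under a nonzero translation is zero (`eq_zero_of_memLp_of_translate_invariant`: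
the disjoint translates of a ball carry equal portions of `∫‖w‖⁶ < ∞`).

References: Giga–Miura 2011 (CMP 303), §2 (continuous alignment ⇒ two-dimensional limit);
Koch–Nadirashvili–Seregin–Šverák 2009, §4; Tsai 1998, pp. 48–49 (harmonic Liouville in `L^q`);
Majda–Bertozzi 2002, Prop. 2.16 (`−Δv = curl ω`).
-/

noncomputable section

-- the summit and its single sub-problem share the name (CONVENTIONS §1), as in every Theorems file
set_option linter.dupNamespace false

namespace Summit.NavierStokesRegularity.NavierStokesRegularity.Theorems.FiniteDissipationLiouville.VorticityAlignment

open MeasureTheory Set Filter Topology Metric Function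
open Literature.Analysis Literature.Analysis.FluidPDE
open Summit.NavierStokesRegularity.NavierStokesRegularity.Theorems.FiniteDissipationLiouville
open scoped ENNReal NNReal Laplacian RealInnerProductSpace

/-! ### Linear algebra of an aligned curl -/

/-- The real inner product on `ℝ³` in coordinates. -/
theorem inner_eq_sum_three (x y : EuclideanSpace ℝ (Fin 3)) :
    ⟪x, y⟫ = x 0 * y 0 + x 1 * y 1 + x 2 * y 2 := by
  simp [PiLp.inner_apply, Fin.sum_univ_three, mul_comm]

/-- `⟪curlCLM (ℓ ⊗ e), e⟫ = 0`: the curl of a rank-one Jacobian `h ↦ ℓ(h) e` is `∇ℓ × e ⊥ e`. -/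
theorem inner_curlCLM_smulRight_self (ℓ : EuclideanSpace ℝ (Fin 3) →L[ℝ] ℝ)
    (e : EuclideanSpace ℝ (Fin 3)) : ⟪curlCLM (ℓ.smulRight e), e⟫ = 0 := by
  rw [inner_eq_sum_three, curlCLM_apply]
  simp only [ContinuousLinearMap.smulRight_apply, PiLp.smul_apply, smul_eq_mul,
    Matrix.cons_val_zero, Matrix.cons_val_one, Matrix.cons_val]
  ring

/-- Coordinates: `(D v)ᵢ = Σₘ vₘ (D eₘ)ᵢ`. -/
theorem clm_apply_coord' (D : EuclideanSpace ℝ (Fin 3) →L[ℝ] EuclideanSpace ℝ (Fin 3))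
    (v : EuclideanSpace ℝ (Fin 3)) (i : Fin 3) :
    D v i = v 0 * D (EuclideanSpace.single 0 1) i + v 1 * D (EuclideanSpace.single 1 1) i +
      v 2 * D (EuclideanSpace.single 2 1) i := by
  rw [clm_apply_coord D v i, Fin.sum_univ_three]

/-- If the curl vector of `D` is parallel to `e` and `e` is orthogonal to the range of `D`, then
`D e = 0` (the derivative along the vorticity direction of a field orthogonal to it vanishes). -/
theorem apply_eq_zero_of_curlCLM_eq_smul {D : EuclideanSpace ℝ (Fin 3) →L[ℝ] EuclideanSpace ℝ (Fin 3)}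
    {e : EuclideanSpace ℝ (Fin 3)} {ρ : ℝ} (hκ : curlCLM D = ρ • e)
    (horth : ∀ b, ⟪D b, e⟫ = 0) : D e = 0 := by
  have hκ' := curlCLM_apply D
  rw [hκ] at hκ'
  have h0 := congrFun (congrArg (fun v : EuclideanSpace ℝ (Fin 3) => (v : Fin 3 → ℝ)) hκ') 0
  have h1 := congrFun (congrArg (fun v : EuclideanSpace ℝ (Fin 3) => (v : Fin 3 → ℝ)) hκ') 1
  have h2 := congrFun (congrArg (fun v : EuclideanSpace ℝ (Fin 3) => (v : Fin 3 → ℝ)) hκ') 2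
  simp only [PiLp.smul_apply, smul_eq_mul, Matrix.cons_val_zero, Matrix.cons_val_one,
    Matrix.cons_val] at h0 h1 h2
  have g0 := horth (EuclideanSpace.single 0 1)
  have g1 := horth (EuclideanSpace.single 1 1)
  have g2 := horth (EuclideanSpace.single 2 1)
  rw [inner_eq_sum_three] at g0 g1 g2
  have c0 : D e 0 = 0 := by
    rw [clm_apply_coord']; linear_combination g0 + e 1 * h2 - e 2 * h1
  have c1 : D e 1 = 0 := by
    rw [clm_apply_coord']; linear_combination g1 - e 0 * h2 + e 2 * h0
  have c2 : D e 2 = 0 := by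
    rw [clm_apply_coord']; linear_combination g2 + e 0 * h1 - e 1 * h0
  ext i
  rw [PiLp.zero_apply]
  fin_cases i
  exacts [c0, c1, c2]


/-! ### Translation-invariant slices in `L⁶` vanish -/

/-- A continuous field on `ℝ³` of class `L⁶` which is invariant under the translation by a nonzero
vector vanishes identically (the translates `B(x₀ + k v, ‖v‖/2)`, `k ∈ ℕ`, are disjoint and carry
the same portion of `∫ ‖f‖⁶ < ∞`). -/
theorem eq_zero_of_memLp_of_translate_invariant
    {f : EuclideanSpace ℝ (Fin 3) → EuclideanSpace ℝ (Fin 3)} (hf : Continuous f)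
    (hmem : MemLp f 6 volume) {v : EuclideanSpace ℝ (Fin 3)} (hv : v ≠ 0)
    (hinv : ∀ x, f (x + v) = f x) : ∀ x, f x = 0 := by
  set g : EuclideanSpace ℝ (Fin 3) → ℝ≥0∞ := fun x => ‖f x‖ₑ ^ 6 with hg
  have hgm : Measurable g := by
    rw [hg]
    exact (hf.measurable.enorm.pow_const 6)
  -- `∫ g < ∞`
  have hI : ∫⁻ x, g x < ⊤ := by
    have h := lintegral_rpow_enorm_lt_top_of_eLpNorm_lt_top (p := (6 : ℝ≥0∞)) (f := f)
      (μ := volume) (by norm_num) (by norm_num) hmem.eLpNorm_lt_top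
    have e6 : ∀ a, ‖f a‖ₑ ^ ((6 : ℝ≥0∞).toReal) = ‖f a‖ₑ ^ 6 := fun a => by
      rw [ENNReal.toReal_ofNat]
      exact_mod_cast ENNReal.rpow_natCast ‖f a‖ₑ 6
    simp_rw [e6] at h
    exact h
  -- invariance under `k • v`, `k ∈ ℕ`
  have hinvk : ∀ (k : ℕ) (x : EuclideanSpace ℝ (Fin 3)), f (x + (k : ℝ) • v) = f x := by
    intro k
    induction k with
    | zero => intro x; simp
    | succ k ih => intro x; rw [Nat.cast_succ, add_smul, one_smul, ← add_assoc, hinv, ih]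
  set r : ℝ := ‖v‖ / 2 with hr_def
  have hvn : 0 < ‖v‖ := norm_pos_iff.2 hv
  have hr : 0 < r := by rw [hr_def]; positivity
  -- the integral over a translated ball equals the integral over the ball
  have hball : ∀ (k : ℕ) (x₀ : EuclideanSpace ℝ (Fin 3)),
      ∫⁻ x in ball (x₀ + (k : ℝ) • v) r, g x = ∫⁻ x in ball x₀ r, g x := by
    intro k x₀
    rw [← lintegral_indicator measurableSet_ball, ← lintegral_indicator measurableSet_ball,
      ← lintegral_add_right_eq_self (μ := volume)
        (fun x => (ball (x₀ + (k : ℝ) • v) r).indicator g x) ((k : ℝ) • v)]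
    refine lintegral_congr fun x => ?_
    have hiff : x + (k : ℝ) • v ∈ ball (x₀ + (k : ℝ) • v) r ↔ x ∈ ball x₀ r := by
      rw [mem_ball, mem_ball, dist_eq_norm, dist_eq_norm, add_sub_add_right_eq_sub]
    by_cases hx : x ∈ ball x₀ r
    · rw [indicator_of_mem (hiff.2 hx), indicator_of_mem hx, hg]
      simp only
      rw [hinvk]
    · rw [indicator_of_notMem (mt hiff.1 hx), indicator_of_notMem hx]
  -- the translated balls are pairwise disjoint
  have hdisj : ∀ (x₀ : EuclideanSpace ℝ (Fin 3)) (N : ℕ),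
      (↑(Finset.range N) : Set ℕ).PairwiseDisjoint fun k => ball (x₀ + (k : ℝ) • v) r := by
    intro x₀ N k _ k' _ hkk'
    refine ball_disjoint_ball ?_
    rw [dist_eq_norm, add_sub_add_left_eq_sub, ← sub_smul, norm_smul, Real.norm_eq_abs]
    have h1 : (1 : ℝ) ≤ |(k : ℝ) - (k' : ℝ)| := by
      rcases Nat.lt_or_gt_of_ne hkk' with h | h
      · have : (k : ℝ) + 1 ≤ k' := by exact_mod_cast h
        rw [abs_sub_comm, abs_of_pos (by linarith)]
        linarith
      · have : (k' : ℝ) + 1 ≤ k := by exact_mod_cast h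
        rw [abs_of_pos (by linarith)]
        linarith
    calc r + r = 1 * ‖v‖ := by rw [hr_def]; ring
      _ ≤ |(k : ℝ) - (k' : ℝ)| * ‖v‖ := by gcongr
  -- suppose `f x₀ ≠ 0`
  intro x₀
  by_contra hx₀
  -- the portion on `B(x₀, r)` is positive
  have hm : 0 < ∫⁻ x in ball x₀ r, g x := by
    -- an open neighbourhood of `x₀` inside the ball where `f ≠ 0`
    have hopen : IsOpen {x : EuclideanSpace ℝ (Fin 3) | f x ≠ 0} :=
      isOpen_ne_fun hf continuous_const
    obtain ⟨ε, hε, hεsub⟩ := Metric.isOpen_iff.1 hopen x₀ hx₀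
    have hsub : ball x₀ (min ε r) ⊆ Function.support g ∩ ball x₀ r := by
      intro x hx
      refine ⟨?_, ball_subset_ball (min_le_right _ _) hx⟩
      have hfx : f x ≠ 0 := hεsub (ball_subset_ball (min_le_left _ _) hx)
      rw [Function.mem_support, hg]
      simp only
      exact pow_ne_zero _ (by simpa using hfx)
    have hpos : 0 < volume (Function.support g ∩ ball x₀ r) :=
      lt_of_lt_of_le (measure_ball_pos volume x₀ (lt_min hε hr)) (measure_mono hsub)
    rw [lintegral_pos_iff_support hgm]  -- w.r.t. the restricted measure
    rwa [Measure.restrict_apply' measurableSet_ball]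
  -- `N · m ≤ ∫ g` for every `N`
  have hsum : ∀ N : ℕ, (N : ℝ≥0∞) * ∫⁻ x in ball x₀ r, g x ≤ ∫⁻ x, g x := by
    intro N
    calc (N : ℝ≥0∞) * ∫⁻ x in ball x₀ r, g x
        = ∑ k ∈ Finset.range N, ∫⁻ x in ball (x₀ + (k : ℝ) • v) r, g x := by
          simp_rw [hball]
          rw [Finset.sum_const, Finset.card_range, nsmul_eq_mul]
      _ = ∫⁻ x in ⋃ k ∈ Finset.range N, ball (x₀ + (k : ℝ) • v) r, g x :=
          (lintegral_biUnion_finset (hdisj x₀ N) (fun k _ => measurableSet_ball) g).symm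
      _ ≤ ∫⁻ x, g x := setLIntegral_le_lintegral _ _
  obtain ⟨N, hN⟩ := ENNReal.exists_nat_mul_gt hm.ne' hI.ne
  exact absurd (hsum N) (not_le.2 hN)

/-! ### An aligned slice vanishes -/

/-- **ALIGNED SLICE ⇒ ZERO.** If at ONE instant `s < 0` the vorticity of a member of `𝒟_{C,K}` is
everywhere parallel to one fixed vector `e` (`curl w(s)(x) = c(x) e`, any signs, zeros allowed),
then the slice vanishes identically: `⟪w(s), e⟫` is harmonic (`−Δw = curl curl w = ∇c × e ⊥ e`)
and in `L⁶`, hence zero (Liouville in `L^q`); then `∂ₑ w(s) = ∇⟪w(s), e⟫ + (curl w(s)) × e`-type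
identity gives `∂ₑ w(s) = 0`, so the slice is invariant under translation by `e`, and an `L⁶`
slice invariant under a nonzero translation is zero. (The case `e = 0` is the irrotational slice,
`QuietVorticity.slice_eq_zero_of_curl_eq_zero`.) [cite: Tsai1998, pp. 48–49] [cite: MajdaBertozziCUP2002, Prop. 2.16] -/
theorem slice_eq_zero_of_curl_parallel {C K : ℝ}
    {w : ℝ → EuclideanSpace ℝ (Fin 3) → EuclideanSpace ℝ (Fin 3)}
    (hw : IsTypeIAncientMild C w)
    (hlaw : ∀ s : ℝ, s < 0 →
      ∫⁻ x, ‖fderiv ℝ (w s) x‖ₑ ^ 2 ≤ ENNReal.ofReal (K / Real.sqrt (-s)))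
    {s : ℝ} (hs : s < 0) (e : EuclideanSpace ℝ (Fin 3))
    (hpar : ∀ x, ∃ c : ℝ, curl (w s) x = c • e) : ∀ x, w s x = 0 := by
  by_cases he : e = 0
  · refine QuietVorticity.slice_eq_zero_of_curl_eq_zero hw hlaw hs fun x => ?_
    obtain ⟨c, hc⟩ := hpar x
    rw [hc, he, smul_zero]
  -- smoothness and integrability of the slice
  have hsm := hw.contDiff_slice hs
  have h2 : ContDiff ℝ 2 (w s) := hsm.of_le (WithTop.coe_le_coe.2 le_top)
  have h3 : ContDiff ℝ 3 (w s) := hsm.of_le (WithTop.coe_le_coe.2 le_top)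
  have hdiff : Differentiable ℝ (w s) := h2.differentiable (by norm_num)
  have hD1 : ContDiff ℝ 1 (fderiv ℝ (w s)) := h3.fderiv_right (by norm_num)
  have hDdiff : Differentiable ℝ (fderiv ℝ (w s)) := hD1.differentiable one_ne_zero
  obtain ⟨CL, -, hL6⟩ := Birth.memLp_six_slice
  have hmem : MemLp (w s) 6 volume := (hL6 C K w hw hlaw s hs).1
  have hen : ‖e‖ ≠ 0 := norm_ne_zero_iff.2 he
  -- the coefficient `ρ` with `curl w(s) = ρ • e`
  set ρ : EuclideanSpace ℝ (Fin 3) → ℝ := fun x => (‖e‖ ^ 2)⁻¹ * ⟪curl (w s) x, e⟫ with hρ_def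
  have hρ : ∀ x, curl (w s) x = ρ x • e := by
    intro x
    obtain ⟨c, hc⟩ := hpar x
    have : ρ x = c := by
      rw [hρ_def]
      simp only
      rw [hc, inner_smul_left, real_inner_self_eq_norm_sq, RCLike.conj_to_real]
      field_simp
    rw [this, hc]
  have hcurl_fun : curl (w s) = fun x => ρ x • e := funext hρ
  have hcurl_diff : Differentiable ℝ (curl (w s)) := by
    rw [curl_eq_curlCLM_comp]
    exact curlCLM.differentiable.comp hDdiff
  have hρdiff : Differentiable ℝ ρ := by
    have h := (hcurl_diff.inner ℝ (differentiable_const e)).const_mul ((‖e‖ ^ 2)⁻¹)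
    rw [hρ_def]
    exact h
  -- Step A: `⟪Δ w(s), e⟫ = 0`
  have hΔe : ∀ x, ⟪(Δ (w s)) x, e⟫ = 0 := by
    intro x
    have hcc := curl_curl_eq_neg_laplacian h2 (hw.isDivFree hs) x
    rw [hcurl_fun, curl_eq_curlCLM, fderiv_smul_const (hρdiff x) e] at hcc
    have h0 := inner_curlCLM_smulRight_self (fderiv ℝ ρ x) e
    rw [hcc, inner_neg_left, neg_eq_zero] at h0
    exact h0
  -- Step B: `φ = ⟪e, w(s)⟫` is harmonic and in `L⁶`, hence zero
  set φ : EuclideanSpace ℝ (Fin 3) → ℝ := fun x => (innerSL ℝ e) (w s x) with hφ_def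
  have hφ_eq : φ = (innerSL ℝ e) ∘ (w s) := rfl
  have hφ2 : ContDiff ℝ 2 φ := by
    rw [hφ_eq]; exact (innerSL ℝ e).contDiff.comp h2
  have hΔφ : ∀ x, (Δ φ) x = 0 := by
    intro x
    rw [hφ_eq, h2.contDiffAt.laplacian_CLM_comp_left]
    simp only [Function.comp_apply, innerSL_apply_apply]
    rw [real_inner_comm]
    exact hΔe x
  have hharm : InnerProductSpace.HarmonicOnNhd φ univ := harmonicOnNhd_of_laplacian_eq_zero hφ2 hΔφ
  have hφmem : MemLp φ 6 volume := by
    rw [hφ_eq]; exact ContinuousLinearMap.comp_memLp' (innerSL ℝ e) hmem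
  have hφ0 : φ = 0 := eq_zero_of_harmonic_memLp hharm (by norm_num) (by norm_num) hφmem
  -- Step C: `∂ₑ w(s) = 0`
  have horth : ∀ x b, ⟪fderiv ℝ (w s) x b, e⟫ = 0 := by
    intro x b
    have h1 : HasFDerivAt φ ((innerSL ℝ e).comp (fderiv ℝ (w s) x)) x := by
      rw [hφ_eq]
      exact (innerSL ℝ e).hasFDerivAt.comp x (hdiff x).hasFDerivAt
    rw [hφ0] at h1
    have h2' : (innerSL ℝ e).comp (fderiv ℝ (w s) x) = 0 :=
      h1.unique (hasFDerivAt_const (0 : ℝ) x)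
    have := DFunLike.congr_fun h2' b
    simp only [ContinuousLinearMap.comp_apply, innerSL_apply_apply,
      _root_.zero_apply] at this
    rwa [real_inner_comm] at this
  have hDe : ∀ x, fderiv ℝ (w s) x e = 0 := by
    intro x
    have hκ : curlCLM (fderiv ℝ (w s) x) = ρ x • e := by rw [← curl_eq_curlCLM, hρ]
    exact apply_eq_zero_of_curlCLM_eq_smul hκ (horth x)
  -- Step D: invariance of the slice under translation by `e`
  have hinv : ∀ x, w s (x + e) = w s x := by
    intro x
    set γ : ℝ → EuclideanSpace ℝ (Fin 3) := fun τ => w s (x + τ • e) with hγ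
    have hγd : ∀ τ, HasDerivAt γ (fderiv ℝ (w s) (x + τ • e) ((1 : ℝ) • e)) τ := by
      intro τ
      have hl : HasDerivAt (fun τ : ℝ => x + τ • e) ((1 : ℝ) • e) τ :=
        ((hasDerivAt_id τ).smul_const e).const_add x
      exact (hdiff (x + τ • e)).hasFDerivAt.comp_hasDerivAt τ hl
    have hγdiff : Differentiable ℝ γ := fun τ => (hγd τ).differentiableAt
    have hγ0 : ∀ τ, deriv γ τ = 0 := fun τ => by
      rw [(hγd τ).deriv, one_smul, hDe]
    have := is_const_of_deriv_eq_zero hγdiff hγ0 1 0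
    simpa [hγ] using this
  -- Step E: an `L⁶` slice invariant under a nonzero translation vanishes
  exact eq_zero_of_memLp_of_translate_invariant (hw.contDiff_slice hs).continuous hmem he hinv

/-- **A member of `𝒟_{C,K}` with ONE aligned slice is regular at the apex** (the slice vanishes,
`slice_eq_zero_of_curl_parallel`; forward uniqueness from the zero slice,
`CalmSlice.not_singular_of_zero_slice`). [cite: Tsai1998, pp. 48–49] -/
theorem not_singular_of_curl_parallel_slice {C K : ℝ}
    {w : ℝ → EuclideanSpace ℝ (Fin 3) → EuclideanSpace ℝ (Fin 3)}
    (hw : IsTypeIAncientMild C w)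
    (hlaw : ∀ s : ℝ, s < 0 →
      ∫⁻ x, ‖fderiv ℝ (w s) x‖ₑ ^ 2 ≤ ENNReal.ofReal (K / Real.sqrt (-s)))
    {s : ℝ} (hs : s < 0) (e : EuclideanSpace ℝ (Fin 3))
    (hpar : ∀ x, ∃ c : ℝ, curl (w s) x = c • e) :
    ¬ (∀ r > 0, ∀ M : ℝ, ∃ t ∈ Ioo (-(r ^ 2)) (0 : ℝ),
        ∃ x ∈ ball (0 : EuclideanSpace ℝ (Fin 3)) r, M < ‖w t x‖) :=
  CalmSlice.not_singular_of_zero_slice hw hs (slice_eq_zero_of_curl_parallel hw hlaw hs e hpar)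


end Summit.NavierStokesRegularity.NavierStokesRegularity.Theorems.FiniteDissipationLiouville.VorticityAlignment

end
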